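import Mathlib

/-!
# SoloBlindSignLaw — bookkeeping certificate for the sign law `ε = χ_p(Π₈)` (solo-blind s166)

Six-line K3 family `K(a,b,c,d) : z² = (w₁²−a²)(w₂²−b²)((w₁+w₂−c)²−d²)`; `T` = orthogonal complement of the
17 tautological classes (15 nodes, `h`, a component at infinity) in `H²`.  The paper-level theorem
(work note `detmono.md`): for every prime `p ≥ 5` and every non-degenerate `(a,b,c,d) ∈ 𝔽_p⁴`,
`det(Frob_p | T(1)) = χ_p(Π₈(a,b,c,d))`, `Π₈ = ∏ (c ± a ± b ± d)`, proved by
(A) a monodromy dichotomy at the `D₄ ← 3A₁` confluences, (B) Kummer theory on the parameter space over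
`ℤ[1/2ℓ]` reducing the determinant character to `κ(u·Π₈^η)`, `u ∈ {±1, ±2}`, `η ∈ {0,1}`, and
(C) two exact fibres (`p = 5, 7`) pinning `η = 1`, `u = 1`.

This file certifies ONLY the finite bookkeeping used there:
* the `D₄` lattice computation behind the dichotomy: the vector `v = α₁+2α₂+α₃+α₄` spans the orthogonal
  complement of the three leaves, has norm `2`, and the reflection `s_v` is an integral isometry of
  determinant `−1` fixing the leaves (`gramD4_*`, `reflV_*`); the form is positive definite (`formD4_*`);
* the Legendre-symbol elimination of the constants `u ∈ {−1, 2, −2}` by the primes `5` and `7`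
  (`u_elimination`), and the "blind spot" `χ_p(−3) = 1 ⟺ p ≡ 1 (mod 3)` on the primes used;
* the Newton identities extracting `e₂, e₃` from the traces `t₁, t₂, t₃` (`newton_e2`, `newton_e3`);
* the point-count identity `12q + (2q−4) + 3(q+1) = 17q − 1`, the symmetries of `Π₈`, the value
  `Π₈(1,1,0,1) = 9`, and the emptiness of the non-degenerate locus over `𝔽₃`.
-/

namespace Summit.HodgeConjecture.HodgeConjecture.Theorems.SoloBlindSignLaw

open Matrix

/-! ## The `D₄` lattice and the reflection `s_v` -/

/-- Gram (Cartan) matrix of `D₄` in the basis `α₁, α₂, α₃, α₄` with `α₂` the central node. -/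
def gramD4 : Matrix (Fin 4) (Fin 4) ℤ := !![2, -1, 0, 0; -1, 2, -1, -1; 0, -1, 2, 0; 0, -1, 0, 2]

/-- The highest root `v = α₁ + 2α₂ + α₃ + α₄` in coordinates. -/
def vD4 : Fin 4 → ℤ := ![1, 2, 1, 1]

/-- Matrix (acting on coordinate column vectors) of the reflection `s_v : x ↦ x − ⟨x,v⟩v`:
it fixes `α₁, α₃, α₄` and sends `α₂ ↦ α₂ − v` (since `⟨α₂, v⟩ = 1`). -/
def reflV : Matrix (Fin 4) (Fin 4) ℤ := !![1, -1, 0, 0; 0, -1, 0, 0; 0, -1, 1, 0; 0, -1, 0, 1]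

/-- `v` is orthogonal to the three (mutually orthogonal) leaves `α₁, α₃, α₄`, pairs to `1` with `α₂`,
and has norm `⟨v,v⟩ = 2`. -/
theorem gramD4_v_pairings :
    gramD4.mulVec vD4 = ![0, 1, 0, 0] ∧ dotProduct vD4 (gramD4.mulVec vD4) = 2 := by
  constructor <;> decide

/-- The leaves `α₁, α₃, α₄` are pairwise orthogonal roots. -/
theorem gramD4_leaves :
    gramD4 0 0 = 2 ∧ gramD4 2 2 = 2 ∧ gramD4 3 3 = 2 ∧
    gramD4 0 2 = 0 ∧ gramD4 0 3 = 0 ∧ gramD4 2 3 = 0 := by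
  decide

/-- `s_v` is an involution different from the identity. -/
theorem reflV_sq : reflV * reflV = 1 ∧ reflV ≠ 1 := by
  constructor <;> decide

/-- `s_v` is an isometry of the `D₄` form: `Sᵀ G S = G`. -/
theorem reflV_isometry : reflV.transpose * gramD4 * reflV = gramD4 := by
  decide

/-- `s_v` fixes the leaves `α₁, α₃, α₄` and negates `v`. -/
theorem reflV_fixes_leaves_negates_v :
    reflV.mulVec ![1, 0, 0, 0] = ![1, 0, 0, 0] ∧ reflV.mulVec ![0, 0, 1, 0] = ![0, 0, 1, 0] ∧
    reflV.mulVec ![0, 0, 0, 1] = ![0, 0, 0, 1] ∧ reflV.mulVec vD4 = -vD4 := by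
  refine ⟨?_, ?_, ?_, ?_⟩ <;> decide

/-- `s_v` agrees with the formula `x ↦ x − ⟨x, v⟩ v` on coordinate vectors. -/
theorem reflV_formula (x : Fin 4 → ℤ) :
    reflV.mulVec x = x - (dotProduct x (gramD4.mulVec vD4)) • vD4 := by
  ext i
  fin_cases i <;>
    simp [reflV, gramD4, vD4, Matrix.mulVec, dotProduct, Fin.sum_univ_four] <;> ring

/-- `det s_v = −1` (so the monodromy alternative "reflection" has determinant `−1` on `T`). -/
theorem reflV_det : reflV.det = -1 := by
  simp [reflV, Matrix.det_succ_row_zero, Fin.sum_univ_succ, Matrix.submatrix]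

/-- `det D₄ = 4`, while the frame `α₁, α₃, α₄, v` has Gram determinant `16`: the sublattice
`A₁³ ⊕ ℤv` has index `2` in `D₄` (in particular `v` spans the rational orthogonal complement of the
three leaves). -/
theorem gramD4_det_and_frame :
    gramD4.det = 4 ∧ (Matrix.of ![![(2:ℤ), 0, 0, 0], ![0, 2, 0, 0], ![0, 0, 2, 0], ![0, 0, 0, 2]]).det = 16 := by
  constructor
  · simp [gramD4, Matrix.det_succ_row_zero, Fin.sum_univ_succ, Matrix.submatrix]
    decide
  · simp [Matrix.det_succ_row_zero, Fin.sum_univ_succ, Matrix.submatrix]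

/-- The quadratic form of `D₄` in coordinates. -/
def formD4 (x₁ x₂ x₃ x₄ : ℚ) : ℚ :=
  2*x₁^2 + 2*x₂^2 + 2*x₃^2 + 2*x₄^2 - 2*x₁*x₂ - 2*x₂*x₃ - 2*x₂*x₄

/-- Sum-of-squares decomposition `2·Q = (2x₁−x₂)² + (2x₃−x₂)² + (2x₄−x₂)² + x₂²`. -/
theorem formD4_sos (x₁ x₂ x₃ x₄ : ℚ) :
    2 * formD4 x₁ x₂ x₃ x₄ = (2*x₁ - x₂)^2 + (2*x₃ - x₂)^2 + (2*x₄ - x₂)^2 + x₂^2 := by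
  unfold formD4; ring

/-- The `D₄` form is positive definite: `Q(x) = 0` only at `x = 0`, and `Q ≥ 0`.  (Hence the local
Milnor lattice `−D₄` is negative definite and `v² ≠ 0`, which is what the dichotomy uses.) -/
theorem formD4_posdef (x₁ x₂ x₃ x₄ : ℚ) :
    0 ≤ formD4 x₁ x₂ x₃ x₄ ∧
    (formD4 x₁ x₂ x₃ x₄ = 0 → x₁ = 0 ∧ x₂ = 0 ∧ x₃ = 0 ∧ x₄ = 0) := by
  have hs := formD4_sos x₁ x₂ x₃ x₄
  constructor
  · nlinarith [sq_nonneg (2*x₁ - x₂), sq_nonneg (2*x₃ - x₂), sq_nonneg (2*x₄ - x₂), sq_nonneg x₂]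
  · intro h0
    have h2 : x₂ = 0 := by
      nlinarith [sq_nonneg (2*x₁ - x₂), sq_nonneg (2*x₃ - x₂), sq_nonneg (2*x₄ - x₂), sq_nonneg x₂]
    subst h2
    have h1 : x₁ = 0 := by nlinarith [sq_nonneg x₁, sq_nonneg x₃, sq_nonneg x₄]
    have h3 : x₃ = 0 := by nlinarith [sq_nonneg x₁, sq_nonneg x₃, sq_nonneg x₄]
    have h4 : x₄ = 0 := by nlinarith [sq_nonneg x₁, sq_nonneg x₃, sq_nonneg x₄]
    exact ⟨h1, rfl, h3, h4⟩

/-! ## Legendre symbols by Euler's criterion -/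

/-- Euler's criterion as a computable function: for an odd prime `p` and `a ∈ ℤ`,
`eulerChi p a = a^((p−1)/2) mod p` read as `1`, `−1` (or `0` if `p ∣ a`). -/
def eulerChi (p : ℕ) (a : ℤ) : ℤ :=
  let r : ℕ := (((a % (p : ℤ)) + p) % (p : ℤ)).toNat ^ ((p - 1) / 2) % p
  if r = 1 then 1 else if r + 1 = p then -1 else 0

/-- The four residue symbols that pin the constant: `χ₅(−1) = 1`, `χ₅(2) = −1`, `χ₇(−1) = −1`,
`χ₇(2) = 1`. -/
theorem chi_5_7_values :
    eulerChi 5 (-1) = 1 ∧ eulerChi 5 2 = -1 ∧ eulerChi 7 (-1) = -1 ∧ eulerChi 7 2 = 1 := by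
  decide

/-- ELIMINATION (LEMMA C(ii)): each of the constants `u = −1, 2, −2` is a quadratic non-residue
modulo `5` or modulo `7`; since the data give `χ₅(u) = χ₇(u) = 1`, `u = 1`. -/
theorem u_elimination :
    ∀ u ∈ ({-1, 2, -2} : Finset ℤ), eulerChi 5 u = -1 ∨ eulerChi 7 u = -1 := by
  decide

/-- The same elimination from the s159 primes: modulo `43` both `−1` and `2` are non-residues, and
modulo `61`, `2` and `−2` are non-residues. -/
theorem u_elimination_s159 :
    eulerChi 43 (-1) = -1 ∧ eulerChi 43 2 = -1 ∧ eulerChi 61 2 = -1 ∧ eulerChi 61 (-2) = -1 := by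
  decide

/-- THE BLIND SPOT: `−3` is a quadratic residue modulo each verification prime `≡ 1 (mod 3)`
(so the laws `χ_p(Π₈)` and `χ_p(−3Π₈)` coincide there) … -/
theorem chi_m3_residue :
    ∀ p ∈ ({7, 13, 19, 31, 37, 43, 61, 67} : Finset ℕ), p % 3 = 1 ∧ eulerChi p (-3) = 1 := by
  decide

/-- … and a non-residue modulo each verification prime `≡ 2 (mod 3)` (where the two laws differ in
every fibre and the data decide for `χ_p(Π₈)`). -/
theorem chi_m3_nonresidue :
    ∀ p ∈ ({5, 11, 17, 23, 29, 41, 47, 53, 59} : Finset ℕ), p % 3 = 2 ∧ eulerChi p (-3) = -1 := by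
  decide

/-! ## Newton identities for five Frobenius eigenvalues -/

/-- `2 e₂ = t₁² − t₂` for five variables. -/
theorem newton_e2 {R : Type*} [CommRing R] (x₁ x₂ x₃ x₄ x₅ : R) :
    2 * (x₁*x₂ + x₁*x₃ + x₁*x₄ + x₁*x₅ + x₂*x₃ + x₂*x₄ + x₂*x₅ + x₃*x₄ + x₃*x₅ + x₄*x₅) =
      (x₁ + x₂ + x₃ + x₄ + x₅)^2 - (x₁^2 + x₂^2 + x₃^2 + x₄^2 + x₅^2) := by
  ring

/-- `6 e₃ = t₁³ − 3 t₁ t₂ + 2 t₃` for five variables. -/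
theorem newton_e3 {R : Type*} [CommRing R] (x₁ x₂ x₃ x₄ x₅ : R) :
    6 * (x₁*x₂*x₃ + x₁*x₂*x₄ + x₁*x₂*x₅ + x₁*x₃*x₄ + x₁*x₃*x₅ + x₁*x₄*x₅ + x₂*x₃*x₄ + x₂*x₃*x₅ +
        x₂*x₄*x₅ + x₃*x₄*x₅) =
      (x₁ + x₂ + x₃ + x₄ + x₅)^3 - 3*(x₁ + x₂ + x₃ + x₄ + x₅)*(x₁^2 + x₂^2 + x₃^2 + x₄^2 + x₅^2) +
        2*(x₁^3 + x₂^3 + x₃^3 + x₄^3 + x₅^3) := by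
  ring

/-- Functional-equation bookkeeping: if the five eigenvalues are `p·μ₁, p·μ₂, p·ε, p·ν₁, p·ν₂` with
`μ₁ν₁ = μ₂ν₂ = 1` and `ε² = 1` (the shape forced by an orthogonal similitude of odd rank 5 with
multiplier `p²`), then `e₃ = ε·p·e₂` — the relation from which `ε` is read off in the engines. -/
theorem fe_e3_eq_eps_p_e2 {R : Type*} [CommRing R] (p μ₁ ν₁ μ₂ ν₂ ε : R)
    (h₁ : μ₁ * ν₁ = 1) (h₂ : μ₂ * ν₂ = 1) (hε : ε ^ 2 = 1) :
    ((p*μ₁)*(p*μ₂)*(p*ε) + (p*μ₁)*(p*μ₂)*(p*ν₁) + (p*μ₁)*(p*μ₂)*(p*ν₂) + (p*μ₁)*(p*ε)*(p*ν₁) +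
        (p*μ₁)*(p*ε)*(p*ν₂) + (p*μ₁)*(p*ν₁)*(p*ν₂) + (p*μ₂)*(p*ε)*(p*ν₁) + (p*μ₂)*(p*ε)*(p*ν₂) +
        (p*μ₂)*(p*ν₁)*(p*ν₂) + (p*ε)*(p*ν₁)*(p*ν₂)) =
      ε * p * ((p*μ₁)*(p*μ₂) + (p*μ₁)*(p*ε) + (p*μ₁)*(p*ν₁) + (p*μ₁)*(p*ν₂) + (p*μ₂)*(p*ε) +
        (p*μ₂)*(p*ν₁) + (p*μ₂)*(p*ν₂) + (p*ε)*(p*ν₁) + (p*ε)*(p*ν₂) + (p*ν₁)*(p*ν₂)) := by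
  linear_combination (p^3*(μ₂ + ν₂)) * h₁ + (p^3*(μ₁ + ν₁)) * h₂ - (p^3*(μ₁ + ν₁ + μ₂ + ν₂)) * hε

/-- Likewise `e₅ = ε p⁵` and `e₄ = ε p³ e₁` under the same shape. -/
theorem fe_e5_e4 {R : Type*} [CommRing R] (p μ₁ ν₁ μ₂ ν₂ ε : R)
    (h₁ : μ₁ * ν₁ = 1) (h₂ : μ₂ * ν₂ = 1) (hε : ε ^ 2 = 1) :
    (p*μ₁)*(p*μ₂)*(p*ε)*(p*ν₁)*(p*ν₂) = ε * p^5 ∧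
    ((p*μ₁)*(p*μ₂)*(p*ε)*(p*ν₁) + (p*μ₁)*(p*μ₂)*(p*ε)*(p*ν₂) + (p*μ₁)*(p*μ₂)*(p*ν₁)*(p*ν₂) +
        (p*μ₁)*(p*ε)*(p*ν₁)*(p*ν₂) + (p*μ₂)*(p*ε)*(p*ν₁)*(p*ν₂)) =
      ε * p^3 * (p*μ₁ + p*μ₂ + p*ε + p*ν₁ + p*ν₂) := by
  constructor
  · linear_combination (p^5*ε*μ₂*ν₂) * h₁ + (p^5*ε) * h₂
  · linear_combination (p^4*(μ₂*ν₂ + ε*(μ₂ + ν₂))) * h₁ + (p^4*(1 + ε*(μ₁ + ν₁))) * h₂ - (p^4) * hε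

/-! ## Point-count identity, `Π₈`, and the prime 3 -/

/-- The contribution of the twelve affine nodes, the line at infinity and its three nodes:
`12q + (2q − 4) + 3(q+1) = 17q − 1` (so `#K(𝔽_q) = q² + 17q − 1 + S`). -/
theorem count_tautological (q : ℤ) : 12*q + (2*q - 4) + 3*(q + 1) = 17*q - 1 := by
  ring

/-- `Π₈(a,b,c,d) = ∏_{signs} (c + ε₁a + ε₂b + ε₃d)`. -/
def Pi8 {R : Type*} [CommRing R] (a b c d : R) : R :=
  (c + a + b + d) * (c + a + b - d) * (c + a - b + d) * (c + a - b - d) *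
  (c - a + b + d) * (c - a + b - d) * (c - a - b + d) * (c - a - b - d)

/-- `Π₈` is invariant under the sign changes of `a`, `b`, `d` (the symmetry (S1) permuting the eight
triple-point planes) and under `c ↦ −c`. -/
theorem Pi8_symmetries {R : Type*} [CommRing R] (a b c d : R) :
    Pi8 (-a) b c d = Pi8 a b c d ∧ Pi8 a (-b) c d = Pi8 a b c d ∧
    Pi8 a b c (-d) = Pi8 a b c d ∧ Pi8 a b (-c) d = Pi8 a b c d := by
  refine ⟨?_, ?_, ?_, ?_⟩ <;> unfold Pi8 <;> ring

/-- The fibre `(1,1,0,1)` used at `p = 5` (and to show the parameter space has `𝔽_p`-points for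
all `p ≥ 5`): `Π₈(1,1,0,1) = 9`. -/
theorem Pi8_1101 : Pi8 (1:ℤ) 1 0 1 = 9 := by
  unfold Pi8; norm_num

/-- Over `𝔽₃` the non-degenerate locus is empty: for `a, b, d ∈ {±1}` and every `c`,
`3 ∣ Π₈(a,b,c,d)`. -/
theorem Pi8_vanishes_mod3 :
    ∀ a ∈ ({1, 2} : Finset ℤ), ∀ b ∈ ({1, 2} : Finset ℤ), ∀ d ∈ ({1, 2} : Finset ℤ),
      ∀ c ∈ ({0, 1, 2} : Finset ℤ), Pi8 a b c d % 3 = 0 := by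
  decide

end Summit.HodgeConjecture.HodgeConjecture.Theorems.SoloBlindSignLaw
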